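import Summits.Ventures.CertifiedQuantumChemistry.Certificates.HubbardRingL4SectorDualNoSpinRow
import HarnessLib

/-!
# Ventures/CertifiedQuantumChemistry — Certificates/HubbardRingL4SectorDualPair.lean: the table-form dual certificate of the
# `(2,2)`-sector DQG programme of the Hubbard 4-ring over `ℚ(√2)` — a PAIR of rational records `d_r + √2·d_s` (soundness from the
# two rational checks and positive semidefiniteness of the three COMBINED real tables)

HONEST FRAMING (verbatim): certified bounds for a stated model Hamiltonian in a stated basis; not a
claim about the real molecule beyond that model. A CERTIFICATE FORMAT statement: no model value, no row, no claim node.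

Seat rdm-B (gen 45). The level-DQG strong-coupling value of the 4-ring is `−8 − 4√2` (gen 42's floor
`Certificates/HubbardRingL4LiftPlateauFloor.lean`), so a dual certificate reaching it has tables in `ℚ(√2)`. Rather than re-typing
`DualL4.Dual` (`Certificates/HubbardRingL4SectorDual.lean`, gen 44) over pairs, this file observes that every defect table of a `Dual`
record is `ℚ`-LINEAR in the record, so a certificate over `ℚ(√2)` is a PAIR `(d_r, d_s)` of rational records read as `d_r + √2·d_s`:
* §1 `pairing_nonneg_real` — weak duality for an arbitrary real positive semidefinite table (gen 44's `pairing_nonneg` is the rational case);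
* §2 **`Dual.target_sub_mu_eq_sector`** — the Lagrangian IDENTITY of a checked record with `xi = 0` at every `IsDQGFeasibleSector 2 2 γ Γ`:
  `cd·Σ doublons + ch·Σ bonds − mu = ⟨zD, Γ⟩ + ⟨zQ, Q(γ,Γ)⟩ + ⟨zG, G(γ,Γ)⟩` (no positivity used; gen 44's `le_of_check_sector` minus its last step);
* §3 **`Dual.le_of_check_sector_pair`** — if `d_r.check = d_s.check = true`, `d_r.xi = d_s.xi = 0` and the three real tables
  `realZ d_r.z• + √2 • realZ d_s.z•` are positive semidefinite, then `mu_r + √2·mu_s ≤ (cd_r + √2·cd_s)·Σ doublons + (ch_r + √2·ch_s)·Σ bonds`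
  at every sector-feasible pair;
* §4 **`Dual.mul_mu_le_pqgSectorEnergy_pair`** — the ring spelling with an integer scale `K > 0` (`cd_r = K`, `ch_r = −2K/U`, `cd_s = ch_s = 0`):
  `(U/K)·(mu_r + √2·mu_s) ≤ Model.pqgSectorEnergy (hubbardRingTV 4 1 U) 2 2`.
The explicit certificate family (tables, checks, positivity) is not in this file. 0 sorry, 0 def; standard axioms. References
(docstring-only): E. Cancès, G. Stoltz, M. Lewin, J. Chem. Phys. 125 (2006) 064101 §3; M. Nakata et al., J. Chem. Phys. 128 (2008)
164113 §II.C–D; D. A. Mazziotti, Adv. Chem. Phys. 134 (2007) ch. 3 §II.B, §II.F.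
-/

set_option linter.style.longLine false

namespace Summit.Ventures.CertifiedQuantumChemistry

namespace DualL4

open Matrix Finset
open Literature.MathematicalPhysics.QuantumLattice Literature.MathematicalPhysics.QuantumChemistry
open Summit.Ventures.CertifiedQuantumChemistry.Hamiltonians
open scoped ComplexOrder

/-! ## §1 Weak duality for a real table -/

/-- `Re tr(Zℂ · M) = Σ_{I,J} Z I J · Re (M J I)` for a real table `Z`. -/
theorem re_trace_mul_eq_real (Z : Matrix OP OP ℝ) (M : Matrix OP OP ℂ) :
    RCLike.re ((Z.map Complex.ofRealHom) * M).trace = ∑ I : OP, ∑ J : OP, Z I J * (M J I).re := by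
  simp only [Matrix.trace, Matrix.diag, Matrix.mul_apply, Matrix.map_apply, Complex.ofRealHom_eq_coe]
  rw [show (RCLike.re (∑ I : OP, ∑ J : OP, ((Z I J : ℝ) : ℂ) * M J I) : ℝ) = (∑ I : OP, ∑ J : OP, ((Z I J : ℝ) : ℂ) * M J I).re from rfl]
  rw [Complex.re_sum]
  refine Finset.sum_congr rfl fun I _ => ?_
  rw [Complex.re_sum]
  refine Finset.sum_congr rfl fun J _ => ?_
  rw [Complex.re_ofReal_mul]

/-- Weak duality for one cone with a REAL positive semidefinite table. -/
theorem pairing_nonneg_real {Z : Matrix OP OP ℝ} (hZ : Z.PosSemidef) {M : Matrix OP OP ℂ} (hM : M.PosSemidef) :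
    0 ≤ ∑ I : OP, ∑ J : OP, Z I J * (M J I).re := by
  rw [← re_trace_mul_eq_real]
  exact Literature.LinearAlgebra.Matrix.NearestPositiveSemidefinite.re_trace_mul_nonneg (DQGGap.posSemidef_map_ofReal hZ) hM

/-- Entries of a combined table `realZ z_r + √2 • realZ z_s`. -/
theorem realZ_pair_apply (zr zs : OP → OP → ℚ) (I J : OP) :
    (Dual.realZ zr + Real.sqrt 2 • Dual.realZ zs) I J = ((zr I J : ℚ) : ℝ) + Real.sqrt 2 * ((zs I J : ℚ) : ℝ) := by
  simp [Dual.realZ, Matrix.add_apply]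

/-- The pairing of a combined table splits into the two rational pairings. -/
theorem pairing_pair_split (zr zs : OP → OP → ℚ) (M : Matrix OP OP ℂ) :
    ∑ I : OP, ∑ J : OP, (Dual.realZ zr + Real.sqrt 2 • Dual.realZ zs) I J * (M J I).re =
      ∑ I : OP, ∑ J : OP, ((zr I J : ℚ) : ℝ) * (M J I).re
        + Real.sqrt 2 * ∑ I : OP, ∑ J : OP, ((zs I J : ℚ) : ℝ) * (M J I).re := by
  simp only [realZ_pair_apply, add_mul, Finset.sum_add_distrib, Finset.mul_sum, mul_assoc]

/-! ## §2 The Lagrangian identity of a checked record (no positivity used) -/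

/-- **THE IDENTITY.** For a record passing `check` with `xi = 0`, at every SECTOR-feasible pair of the `(2,2)` sector of the 4-ring:
`cd·Σ_p Re Γ_{(p↑p↓),(p↑p↓)} + ch·Σ_{p,σ} Re γ_{pσ,(p+1)σ} − mu = ⟨zD, Γ⟩ + ⟨zQ, qMap γ Γ⟩ + ⟨zG, gMap γ Γ⟩` (the rows vanish on the
feasible set; the canonical defects vanish by `check`). -/
theorem Dual.target_sub_mu_eq_sector (d : Dual) (hc : d.check = true) (hxi : d.xi = 0) {γ : Matrix O4 O4 ℂ} {Γ : Matrix OP OP ℂ}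
    (hs : IsDQGFeasibleSector 2 2 γ Γ) :
    (d.cd : ℝ) * ∑ p : Fin 4, (Γ (orb p 0, orb p 1) (orb p 0, orb p 1)).re
      + (d.ch : ℝ) * ∑ p : Fin 4, ∑ σ : Fin 2, (γ (orb p σ) (orb (finRotate 4 p) σ)).re - (d.mu : ℝ)
      = ∑ I : OP, ∑ J : OP, ((d.zD I J : ℚ) : ℝ) * (Γ J I).re
        + ∑ I : OP, ∑ J : OP, ((d.zQ I J : ℚ) : ℝ) * (qMap γ Γ J I).re
        + ∑ I : OP, ∑ J : OP, ((d.zG I J : ℚ) : ℝ) * (gMap γ Γ J I).re := by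
  have hq : IsDQGFeasible (2 + 2) γ Γ := hs.dqg
  -- the three pairings on raw moments
  have eD := pairD_eq d Γ
  have eQ := pairQ_eq d γ Γ
  have eG := pairG_eq d γ Γ
  -- rows
  have rNu : ∑ P' : O4, ∑ k : O4, ∑ τ : Fin 2, ((d.nu P' k τ : ℚ) : ℝ) * ∑ y : Fin 4, (Γ (P', orb y τ) (k, orb y τ)).re =
      ∑ P' : O4, ∑ k : O4, ∑ τ : Fin 2, ((d.nu P' k τ : ℚ) : ℝ) * ((2 - (if τ = sp k then 1 else 0)) * (γ P' k).re) := by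
    refine Finset.sum_congr rfl fun P' _ => Finset.sum_congr rfl fun k _ => Finset.sum_congr rfl fun τ _ => ?_
    rw [e2_row hs]
  rw [nuRowsΓ_eq, nuRowsγ_eq] at rNu
  have rOne : ∑ i : O4, (γ i i).re = 4 := by
    have h := congrArg Complex.re hq.trace_one; rw [Complex.re_sum] at h; simpa using h
  have rUp : ∑ p : Fin 4, (γ (orb p 0) (orb p 0)).re = 2 := by
    have h := congrArg Complex.re hs.trace_up; rw [Complex.re_sum] at h; simpa using h
  have rDn : ∑ p : Fin 4, (γ (orb p 1) (orb p 1)).re = 2 := by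
    have h := congrArg Complex.re hs.trace_down; rw [Complex.re_sum] at h; simpa using h
  have rUU : ∑ x : Fin 4, ∑ y : Fin 4, (Γ (orb x 0, orb y 0) (orb x 0, orb y 0)).re = 2 := by
    have h := congrArg Complex.re hs.trace_upUp; simp only [Complex.re_sum] at h; push_cast at h; norm_num at h; exact h
  have rDD : ∑ x : Fin 4, ∑ y : Fin 4, (Γ (orb x 1, orb y 1) (orb x 1, orb y 1)).re = 2 := by
    have h := congrArg Complex.re hs.trace_downDown; simp only [Complex.re_sum] at h; push_cast at h; norm_num at h; exact h
  have rUD : ∑ x : Fin 4, ∑ y : Fin 4, (Γ (orb x 0, orb y 1) (orb x 0, orb y 1)).re = 4 := by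
    have h := congrArg Complex.re hs.trace_upDown; simp only [Complex.re_sum] at h; push_cast at h; norm_num at h; exact h
  have rEx : (d.xi : ℝ) * ∑ x : Fin 4, ∑ y : Fin 4, (Γ (orb x 0, orb y 1) (orb y 0, orb x 1)).re = 0 := by
    rw [hxi]; push_cast; ring
  have rEx' : (2 : ℝ) * d.xi = 0 := by rw [hxi]; push_cast; ring
  -- the canonical defects vanish
  obtain ⟨hcΓ, hcγ, hc0⟩ := d.check_spec hc
  have zΓ : ∑ P : OP, ∑ R : OP, ((d.defΓ P R : ℚ) : ℝ) * (Γ P R).re = 0 := by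
    rw [sum_defΓ_canon d hq.d_psd.1 hq.swap_fst hq.swap_snd]
    have : ∀ P R : OP, d.cdefΓ P R = 0 := by
      rintro ⟨x, y⟩ ⟨u, v⟩
      rw [← orb_st_sp x, ← orb_st_sp y, ← orb_st_sp u, ← orb_st_sp v]
      exact hcΓ _ _ _ _ _ _ _ _
    simp [this]
  have zγ : ∑ x : O4, ∑ y : O4, ((d.defγ x y : ℚ) : ℝ) * (γ x y).re = 0 := by
    rw [sum_defγ_canon d hq.herm_one hs.spin_sel]
    have : ∀ x y : O4, d.cdefγ x y = 0 := by
      intro x y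
      rw [← orb_st_sp x, ← orb_st_sp y]
      exact hcγ _ _ _ _
    simp [this]
  have z0 : ((d.def0 : ℚ) : ℝ) = 0 := by rw [hc0]; push_cast; ring
  rw [sum_defΓ_eq, rUU, rDD, rUD, rEx] at zΓ
  rw [sum_defγ_eq, rOne, rUp, rDn] at zγ
  rw [def0_eq] at z0
  linarith [eD, eQ, eG, rNu, zΓ, zγ, z0, rEx']

/-! ## §3 SOUNDNESS OF THE PAIR CERTIFICATE `d_r + √2·d_s` -/

/-- **SOUNDNESS OVER `ℚ(√2)`.** Two rational records passing `check` with `xi = 0` whose COMBINED real tables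
`realZ d_r.z• + √2 • realZ d_s.z•` (`• = D, Q, G`) are positive semidefinite certify, at every sector-feasible pair of the `(2,2)`
sector of the 4-ring, `mu_r + √2·mu_s ≤ (cd_r + √2·cd_s)·Σ_p Re Γ_{(p↑p↓),(p↑p↓)} + (ch_r + √2·ch_s)·Σ_{p,σ} Re γ_{pσ,(p+1)σ}`. -/
theorem Dual.le_of_check_sector_pair (dr ds : Dual) (hcr : dr.check = true) (hcs : ds.check = true) (hxr : dr.xi = 0)
    (hxs : ds.xi = 0) (hD : (Dual.realZ dr.zD + Real.sqrt 2 • Dual.realZ ds.zD).PosSemidef)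
    (hQ : (Dual.realZ dr.zQ + Real.sqrt 2 • Dual.realZ ds.zQ).PosSemidef)
    (hG : (Dual.realZ dr.zG + Real.sqrt 2 • Dual.realZ ds.zG).PosSemidef)
    {γ : Matrix O4 O4 ℂ} {Γ : Matrix OP OP ℂ} (hs : IsDQGFeasibleSector 2 2 γ Γ) :
    (dr.mu : ℝ) + Real.sqrt 2 * (ds.mu : ℝ) ≤
      ((dr.cd : ℝ) + Real.sqrt 2 * (ds.cd : ℝ)) * ∑ p : Fin 4, (Γ (orb p 0, orb p 1) (orb p 0, orb p 1)).re
        + ((dr.ch : ℝ) + Real.sqrt 2 * (ds.ch : ℝ)) * ∑ p : Fin 4, ∑ σ : Fin 2, (γ (orb p σ) (orb (finRotate 4 p) σ)).re := by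
  have hq : IsDQGFeasible (2 + 2) γ Γ := hs.dqg
  have ir := dr.target_sub_mu_eq_sector hcr hxr hs
  have is := ds.target_sub_mu_eq_sector hcs hxs hs
  have pD := pairing_nonneg_real hD hq.d_psd
  have pQ := pairing_nonneg_real hQ hq.q_psd
  have pG := pairing_nonneg_real hG hq.g_psd
  rw [pairing_pair_split] at pD pQ pG
  set Dbl := ∑ p : Fin 4, (Γ (orb p 0, orb p 1) (orb p 0, orb p 1)).re with hDbl
  set Bnd := ∑ p : Fin 4, ∑ σ : Fin 2, (γ (orb p σ) (orb (finRotate 4 p) σ)).re with hBnd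
  set aD := ∑ I : OP, ∑ J : OP, ((dr.zD I J : ℚ) : ℝ) * (Γ J I).re with haD
  set aQ := ∑ I : OP, ∑ J : OP, ((dr.zQ I J : ℚ) : ℝ) * (qMap γ Γ J I).re with haQ
  set aG := ∑ I : OP, ∑ J : OP, ((dr.zG I J : ℚ) : ℝ) * (gMap γ Γ J I).re with haG
  set bD := ∑ I : OP, ∑ J : OP, ((ds.zD I J : ℚ) : ℝ) * (Γ J I).re with hbD
  set bQ := ∑ I : OP, ∑ J : OP, ((ds.zQ I J : ℚ) : ℝ) * (qMap γ Γ J I).re with hbQ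
  set bG := ∑ I : OP, ∑ J : OP, ((ds.zG I J : ℚ) : ℝ) * (gMap γ Γ J I).re with hbG
  have e : ((dr.cd : ℝ) + Real.sqrt 2 * (ds.cd : ℝ)) * Dbl + ((dr.ch : ℝ) + Real.sqrt 2 * (ds.ch : ℝ)) * Bnd
      - ((dr.mu : ℝ) + Real.sqrt 2 * (ds.mu : ℝ)) = (aD + Real.sqrt 2 * bD) + (aQ + Real.sqrt 2 * bQ) + (aG + Real.sqrt 2 * bG) := by
    linear_combination ir + Real.sqrt 2 * is
  linarith [e, pD, pQ, pG]

/-! ## §4 The bound spelt on `hubbardRingTV 4 1 U` with an integer scale -/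

/-- **`(U/K)·(mu_r + √2·mu_s) ≤ E_PQG(hubbardRingTV 4 1 U; 2, 2)`** (the plain sector value `Model.pqgSectorEnergy`) for a sound pair
whose target is `K` times the ring energy divided by `U`: `cd_r = K > 0`, `ch_r = −2K/U`, `cd_s = ch_s = 0`, `U > 0` (gen 39's
`Re E = −2·Σ bonds + U·Σ doublons`). -/
theorem Dual.mul_mu_le_pqgSectorEnergy_pair (dr ds : Dual) (hcr : dr.check = true) (hcs : ds.check = true) (hxr : dr.xi = 0)
    (hxs : ds.xi = 0) (hD : (Dual.realZ dr.zD + Real.sqrt 2 • Dual.realZ ds.zD).PosSemidef)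
    (hQ : (Dual.realZ dr.zQ + Real.sqrt 2 • Dual.realZ ds.zQ).PosSemidef)
    (hG : (Dual.realZ dr.zG + Real.sqrt 2 • Dual.realZ ds.zG).PosSemidef) {U K : ℚ} (hU : 0 < U) (hK : 0 < K)
    (hcd : dr.cd = K) (hcds : ds.cd = 0) (hch : dr.ch = -2 * K / U) (hchs : ds.ch = 0) :
    (U : ℝ) / K * ((dr.mu : ℝ) + Real.sqrt 2 * (ds.mu : ℝ)) ≤ Model.pqgSectorEnergy (hubbardRingTV 4 1 U) 2 2 := by
  rw [Model.pqgSectorEnergy, le_pqgSectorEnergy_iff _ _ _ (by simp) (by simp)]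
  intro γ Γ hs
  have h := Dual.le_of_check_sector_pair dr ds hcr hcs hxr hxs hD hQ hG hs
  rw [RingEnergy.hubbardRingTV_re_rdmEnergy_eq_of_feasible (by norm_num) 1 U hs]
  rw [hcd, hcds, hch, hchs] at h
  push_cast at h
  have hU' : (0 : ℝ) < U := by exact_mod_cast hU
  have hK' : (0 : ℝ) < K := by exact_mod_cast hK
  have hUK : (0 : ℝ) ≤ (U : ℝ) / K := by positivity
  set Dbl := ∑ p : Fin 4, (Γ (orb p 0, orb p 1) (orb p 0, orb p 1)).re with hDbl
  set Bnd := ∑ p : Fin 4, ∑ σ : Fin 2, (γ (orb p σ) (orb (finRotate 4 p) σ)).re with hBnd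
  have key := mul_le_mul_of_nonneg_left h hUK
  have e : (U : ℝ) / K * (((K : ℝ) + Real.sqrt 2 * 0) * Dbl + (-2 * (K : ℝ) / U + Real.sqrt 2 * 0) * Bnd) =
      -2 * ((1 : ℚ) : ℝ) * Bnd + (U : ℝ) * Dbl := by
    field_simp
    ring
  rw [← e]
  exact key

end DualL4

end Summit.Ventures.CertifiedQuantumChemistry
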